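import Summits.RiemannHypothesis.RiemannHypothesis.Theorems.SignConeExactConeRigidityChain
import Summits.RiemannHypothesis.RiemannHypothesis.Theorems.SignConeConeMagnificationStubDeficitOfTorus

/-!
# Route SignCone, item `ExactConeRigidity` (stmt-RiemannHypothesis-16306): what the exact chain needs —
one-sided prime domination, and the crux's torus inequality BY NAME

After sessions 0/c1 the item is the Landau transfer applied to ONE exact-cone weight `c ≥ 0` (`c 1 = 0`,
`0 ≤ Re (W_ar − P_c)(φ ⋆ φ̃)` for every Weil test `φ`), modulo a one-sided abscissa theorem
(`SignConeExactConeRigidityChain`).  This file records, sorry-free, how LITTLE one-sided information closes it,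
and ties the item by name to the single open analytic stub of crux `ConeMagnification`
(stmt-RiemannHypothesis-16303, line `Sketch`, `stub_torusIneq`):

* `unitSlackWeight_continuation` — the analytic package (`Σ c(n) n^{-σ} < ∞` for `σ > 1`, local continuation
  of `L_c − 1/(s−1)` to `Re s > 1/2`) of a UNIT-SLACK weight (`stub_fakePNT`, `LSeriesSummable_of_unitSlack`,
  `stub_continuation`; the exact twin is `exactWeight_continuation`).
* `riemannHypothesis_of_unitSlackWeight_of_finite_deficit` — a unit-slack weight with only FINITELY MANY
  deficit primes (`c p < log p`) already forces RH (`stub_transfer` with a finitely supported deficit series);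
  `…_of_deficit_summable_sqrt` — the same from `Σ_p (log p − c p)₊/√p < ∞`; exact twins
  `riemannHypothesis_of_exactWeight_of_finite_deficit`, `riemannHypothesis_of_exactWeight_of_prime_le`.
* `ExactConeRigidity_of_primeDomination` — the route item from ONE-SIDED PRIME DOMINATION off a finite set
  (`log p ≤ c p` for all but finitely many primes `p`) of exact-cone weights: no composite vanishing (W-COMP),
  no prime powers, no equality (W-SRPP) is needed for the exact chain.
* `ExactConeRigidity_of_exactTorusIneq` — the route item from the EXACT (slack `0`) torus inequality
  `Σ_{A ⊆ S} (c(n_A) − Λ(n_A)) n_A^{-1/2} 2^{-|A|} cos(|A|φ) ≤ 0`: at singletons `S = {p}`, `φ = π` it is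
  `log p ≤ c p`.
* `ExactConeRigidity_of_torusIneq` — the route item from the verbatim signature of the crux's registered
  open stub `stub_torusIneq` (unit-slack torus inequality; exact ⇒ unit slack, then the LANDED
  `stub_deficitOfTorus` p131512 and `stub_transfer` p130783): the item closes the moment that stub lands.

Mathematical status (see the evidence note RIGIDITY-ANALYSIS.md on the item): for an exact-cone weight the
Carathéodory function is `H_c = ξ′/ξ + (L_Λ − L_c)` on `Re s > 1/2` (`B := ξ′/ξ − ζ′/ζ = 1/s + 1/(s−1) +
ψ(s/2)/2 − (log π)/2` is the zero-free archimedean–polar symbol), so `Λ ∈ K_exact ⇔ Re ξ′/ξ ≥ 0 ⇔ RH`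
(Lagarias 1999 (1.5)); the missing input in every formulation is the passage from this positivity to the
coefficients `c(p) − log p` for an infinitely supported `c − Λ` (2001 resonator / twisted-second-moment
inequality), which is exactly `stub_torusIneq`.
-/

noncomputable section

-- `Summit.RiemannHypothesis.RiemannHypothesis.…` repeats a namespace component by design (D-0017 layout).
set_option linter.dupNamespace false

open scoped BigOperators ArithmeticFunction.vonMangoldt Real
open Complex MeasureTheory Set Filter LSeries

namespace Summit.RiemannHypothesis.RiemannHypothesis.Theorems.SignConeExactConeRigidity

open Literature.NumberTheory.LFunctions
open Summit.RiemannHypothesis.RiemannHypothesis.Theorems.SignCone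
open Summit.RiemannHypothesis.RiemannHypothesis.Theorems.SignConeConeMagnification
open Summit.RiemannHypothesis.RiemannHypothesis.Cruxes.ConeMagnification.Sketch

variable {c : ℕ → ℝ}

/-! ## The analytic package of a unit-slack weight -/

/-- **The analytic package of a unit-slack weight** (all in the tree): if `c ≥ 0` has unit slack against
every Weil test, then `Σ c(n) n^{-σ} < ∞` for `σ > 1` and `L_c(s) − 1/(s−1)` continues holomorphically to a
thin rectangle through every point of `Re s > 1/2` (`stub_fakePNT`, `LSeriesSummable_of_unitSlack`,
`stub_continuation`). -/
theorem unitSlackWeight_continuation (hc : ∀ n, 0 ≤ c n)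
    (hU1 : ∀ φ : ℝ → ℂ, IsWeilTest φ →
      -(∫ t, ‖φ t‖ ^ 2) ≤
        (weilPolarTerm (weilConv φ (weilReflect φ)) + weilArchTerm (weilConv φ (weilReflect φ)) -
          ∑' n : ℕ, ((c n : ℝ) : ℂ) / (Real.sqrt n : ℂ) *
            (weilConv φ (weilReflect φ) (Real.log n) + weilConv φ (weilReflect φ) (-Real.log n))).re) :
    (∀ σ : ℝ, 1 < σ → LSeriesSummable (fun n => ((c n : ℝ) : ℂ)) σ) ∧
      ∀ s₀ : ℂ, 1 / 2 < s₀.re → ∃ η : ℝ, 0 < η ∧ ∃ F : ℂ → ℂ,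
        DifferentiableOn ℂ F {s : ℂ | 1 / 2 < s.re ∧ s.re < s₀.re + 1 ∧ s₀.im - η < s.im ∧ s.im < s₀.im + η} ∧
        ∀ s ∈ {s : ℂ | 1 / 2 < s.re ∧ s.re < s₀.re + 1 ∧ s₀.im - η < s.im ∧ s.im < s₀.im + η},
          1 < s.re → F s = LSeries (fun n => ((c n : ℝ) : ℂ)) s - 1 / (s - 1) := by
  have hPNT := stub_fakePNT c hc hU1
  have hsum : ∀ σ : ℝ, 1 < σ → LSeriesSummable (fun n => ((c n : ℝ) : ℂ)) σ := fun σ hσ =>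
    LSeriesSummable_of_unitSlack hU1 hc hσ
  exact ⟨hsum, stub_continuation c hc hPNT hsum⟩

/-! ## How little one-sided information the Landau transfer needs -/

/-- Deficit summability at the scale `1/2` gives it at every `σ > 1/2` (termwise domination,
`√p ≤ p^σ`). -/
theorem summable_deficit_rpow_of_summable_sqrt
    (h : Summable (fun p : ℕ => if p.Prime then max (Real.log p - c p) 0 / Real.sqrt p else 0))
    {σ : ℝ} (hσ : 1 / 2 < σ) :
    Summable (fun p : ℕ => if p.Prime then max (Real.log p - c p) 0 / (p : ℝ) ^ σ else 0) := by
  refine Summable.of_nonneg_of_le (fun p => ?_) (fun p => ?_) h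
  · split
    · exact div_nonneg (le_max_right _ _) (Real.rpow_nonneg (Nat.cast_nonneg p) σ)
    · exact le_rfl
  · by_cases hp : p.Prime
    · rw [if_pos hp, if_pos hp]
      have hp1 : (1 : ℝ) ≤ (p : ℝ) := by exact_mod_cast hp.one_lt.le
      have hppos : (0 : ℝ) < (p : ℝ) := by exact_mod_cast hp.pos
      have hs : Real.sqrt p ≤ (p : ℝ) ^ σ := by
        rw [Real.sqrt_eq_rpow]
        exact Real.rpow_le_rpow_of_exponent_le hp1 hσ.le
      exact div_le_div_of_nonneg_left (le_max_right _ _) (Real.sqrt_pos.2 hppos) hs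
    · rw [if_neg hp, if_neg hp]

/-- **Finitely many deficit primes force RH (unit slack).** If `c ≥ 0` has unit slack against every Weil
test and `log p ≤ c p` for every prime `p` outside a finite set `S`, then RH: the deficit series of
`stub_transfer` is finitely supported. -/
theorem riemannHypothesis_of_unitSlackWeight_of_finite_deficit (hc : ∀ n, 0 ≤ c n)
    (hU1 : ∀ φ : ℝ → ℂ, IsWeilTest φ →
      -(∫ t, ‖φ t‖ ^ 2) ≤
        (weilPolarTerm (weilConv φ (weilReflect φ)) + weilArchTerm (weilConv φ (weilReflect φ)) -
          ∑' n : ℕ, ((c n : ℝ) : ℂ) / (Real.sqrt n : ℂ) *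
            (weilConv φ (weilReflect φ) (Real.log n) + weilConv φ (weilReflect φ) (-Real.log n))).re)
    (S : Finset ℕ) (hS : ∀ p : ℕ, p.Prime → p ∉ S → Real.log p ≤ c p) :
    RiemannHypothesis := by
  obtain ⟨hsum, hcont⟩ := unitSlackWeight_continuation hc hU1
  refine stub_transfer c hc hsum hcont fun σ _ => ?_
  refine summable_of_ne_finset_zero (s := S) fun p hp => ?_
  by_cases hpr : p.Prime
  · rw [if_pos hpr, max_eq_right (sub_nonpos.2 (hS p hpr hp)), zero_div]
  · rw [if_neg hpr]

/-- **Deficit summability at `σ = 1/2` forces RH (unit slack).** If `c ≥ 0` has unit slack against every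
Weil test and `Σ_p (log p − c p)₊ /√p < ∞`, then RH. -/
theorem riemannHypothesis_of_unitSlackWeight_of_deficit_summable_sqrt (hc : ∀ n, 0 ≤ c n)
    (hU1 : ∀ φ : ℝ → ℂ, IsWeilTest φ →
      -(∫ t, ‖φ t‖ ^ 2) ≤
        (weilPolarTerm (weilConv φ (weilReflect φ)) + weilArchTerm (weilConv φ (weilReflect φ)) -
          ∑' n : ℕ, ((c n : ℝ) : ℂ) / (Real.sqrt n : ℂ) *
            (weilConv φ (weilReflect φ) (Real.log n) + weilConv φ (weilReflect φ) (-Real.log n))).re)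
    (h : Summable (fun p : ℕ => if p.Prime then max (Real.log p - c p) 0 / Real.sqrt p else 0)) :
    RiemannHypothesis := by
  obtain ⟨hsum, hcont⟩ := unitSlackWeight_continuation hc hU1
  exact stub_transfer c hc hsum hcont fun σ hσ => summable_deficit_rpow_of_summable_sqrt h hσ

/-- **Finitely many deficit primes force RH (exact cone).** If `c ≥ 0` is exact-feasible against every Weil
test and `log p ≤ c p` for every prime `p` outside a finite set `S`, then RH. -/
theorem riemannHypothesis_of_exactWeight_of_finite_deficit (hc : ∀ n, 0 ≤ c n)
    (hU0 : ∀ φ : ℝ → ℂ, IsWeilTest φ →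
      0 ≤ (weilPolarTerm (weilConv φ (weilReflect φ)) + weilArchTerm (weilConv φ (weilReflect φ)) -
          ∑' n : ℕ, ((c n : ℝ) : ℂ) / (Real.sqrt n : ℂ) *
            (weilConv φ (weilReflect φ) (Real.log n) + weilConv φ (weilReflect φ) (-Real.log n))).re)
    (S : Finset ℕ) (hS : ∀ p : ℕ, p.Prime → p ∉ S → Real.log p ≤ c p) :
    RiemannHypothesis :=
  riemannHypothesis_of_unitSlackWeight_of_finite_deficit hc (unitSlack_of_exact hU0) S hS

/-- **One-sided prime domination forces RH (exact cone).** If `c ≥ 0` is exact-feasible against every Weil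
test and dominates `Λ` on the primes, `log p ≤ c p`, then RH. -/
theorem riemannHypothesis_of_exactWeight_of_prime_le (hc : ∀ n, 0 ≤ c n)
    (hU0 : ∀ φ : ℝ → ℂ, IsWeilTest φ →
      0 ≤ (weilPolarTerm (weilConv φ (weilReflect φ)) + weilArchTerm (weilConv φ (weilReflect φ)) -
          ∑' n : ℕ, ((c n : ℝ) : ℂ) / (Real.sqrt n : ℂ) *
            (weilConv φ (weilReflect φ) (Real.log n) + weilConv φ (weilReflect φ) (-Real.log n))).re)
    (h : ∀ p : ℕ, p.Prime → Real.log p ≤ c p) :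
    RiemannHypothesis :=
  riemannHypothesis_of_exactWeight_of_finite_deficit hc hU0 ∅ fun p hp _ => h p hp

/-! ## The item from one-sided prime domination / the exact torus inequality / the crux's stub -/

/-- **`ExactConeRigidity` from one-sided prime domination.** If every weight `c ≥ 0`, `c 1 = 0`, that is
exact-feasible against every Weil test (with its automatic analytic package) satisfies `log p ≤ c p` for all
primes `p` outside some finite set, then the route item `ExactConeRigidity` holds.  (The 2001 rigidity
`K = {Λ}` — W-COMP + W-SRPP — is far more than the exact chain needs.) -/
theorem ExactConeRigidity_of_primeDomination
    (hP : ∀ c : ℕ → ℝ, (∀ n, 0 ≤ c n) → c 1 = 0 →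
      (∀ φ : ℝ → ℂ, IsWeilTest φ →
        0 ≤ (weilPolarTerm (weilConv φ (weilReflect φ)) + weilArchTerm (weilConv φ (weilReflect φ)) -
            ∑' n : ℕ, ((c n : ℝ) : ℂ) / (Real.sqrt n : ℂ) *
              (weilConv φ (weilReflect φ) (Real.log n) + weilConv φ (weilReflect φ) (-Real.log n))).re) →
      (∀ σ : ℝ, 1 < σ → LSeriesSummable (fun n => ((c n : ℝ) : ℂ)) σ) →
      (∀ s₀ : ℂ, 1 / 2 < s₀.re → ∃ η : ℝ, 0 < η ∧ ∃ F : ℂ → ℂ,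
        DifferentiableOn ℂ F {s : ℂ | 1 / 2 < s.re ∧ s.re < s₀.re + 1 ∧ s₀.im - η < s.im ∧ s.im < s₀.im + η} ∧
        ∀ s ∈ {s : ℂ | 1 / 2 < s.re ∧ s.re < s₀.re + 1 ∧ s₀.im - η < s.im ∧ s.im < s₀.im + η},
          1 < s.re → F s = LSeries (fun n => ((c n : ℝ) : ℂ)) s - 1 / (s - 1)) →
      ∃ S : Finset ℕ, ∀ p : ℕ, p.Prime → p ∉ S → Real.log p ≤ c p) :
    Theses.SignCone.ExactConeRigidity := by
  intro hexact
  obtain ⟨c, hc0, hc1, hU0⟩ := exists_exactWeight_of_exactSignCone hexact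
  obtain ⟨hsum, hcont⟩ := exactWeight_continuation hc0 hU0
  obtain ⟨S, hS⟩ := hP c hc0 hc1 hU0 hsum hcont
  exact riemannHypothesis_of_exactWeight_of_finite_deficit hc0 hU0 S hS

/-- The torus sum at a singleton `S = {p}`: `c 1 + (c p − Λ p)/√p · (1/2) · cos φ`. -/
theorem sum_powerset_singleton_torus (c : ℕ → ℝ) (p : ℕ) (φ : ℝ) :
    ∑ A ∈ ({p} : Finset ℕ).powerset, (c (∏ q ∈ A, q) - Λ (∏ q ∈ A, q)) /
        Real.sqrt (∏ q ∈ A, (q : ℝ)) * (1 / 2) ^ A.card * Real.cos ((A.card : ℝ) * φ) =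
      c 1 + (c p - Λ p) / Real.sqrt p * (1 / 2) * Real.cos φ := by
  rw [← Finset.insert_empty (a := p), Finset.sum_powerset_insert (Finset.notMem_empty p),
    Finset.powerset_empty, Finset.sum_singleton, Finset.sum_singleton, Finset.insert_empty]
  simp [ArithmeticFunction.vonMangoldt_apply_one]

/-- The EXACT torus inequality at a singleton and phase `π` is one-sided prime domination:
if `c 1 = 0` and `Σ_{A ⊆ {p}} … ≤ 0` at `φ = π`, then `log p ≤ c p`. -/
theorem log_le_of_exactTorus_singleton {p : ℕ} (hp : p.Prime) (hc1 : c 1 = 0)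
    (h : ∑ A ∈ ({p} : Finset ℕ).powerset, (c (∏ q ∈ A, q) - Λ (∏ q ∈ A, q)) /
        Real.sqrt (∏ q ∈ A, (q : ℝ)) * (1 / 2) ^ A.card * Real.cos ((A.card : ℝ) * Real.pi) ≤ 0) :
    Real.log p ≤ c p := by
  rw [sum_powerset_singleton_torus, hc1, zero_add, Real.cos_pi,
    ArithmeticFunction.vonMangoldt_apply_prime hp] at h
  have hsqrt : 0 < Real.sqrt p := Real.sqrt_pos.2 (by exact_mod_cast hp.pos)
  have h' : 0 ≤ (c p - Real.log p) / Real.sqrt p := by nlinarith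
  have h'' := (div_nonneg_iff.1 h')
  rcases h'' with ⟨hnum, _⟩ | ⟨_, hden⟩
  · linarith
  · linarith [hsqrt, hden]

/-- **`ExactConeRigidity` from the EXACT torus inequality** (slack `0`: the exact-cone analogue of the
crux's `stub_torusIneq`).  If every exact-cone weight (with its analytic package) satisfies
`Σ_{A ⊆ S} (c(n_A) − Λ(n_A)) n_A^{-1/2} 2^{-|A|} cos(|A| φ) ≤ 0` for every finite set `S` of primes and every
phase `φ`, then the route item holds — only singletons `S = {p}` and `φ = π` are used. -/
theorem ExactConeRigidity_of_exactTorusIneq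
    (hT0 : ∀ c : ℕ → ℝ, (∀ n, 0 ≤ c n) → c 1 = 0 →
      (∀ φ : ℝ → ℂ, IsWeilTest φ →
        0 ≤ (weilPolarTerm (weilConv φ (weilReflect φ)) + weilArchTerm (weilConv φ (weilReflect φ)) -
            ∑' n : ℕ, ((c n : ℝ) : ℂ) / (Real.sqrt n : ℂ) *
              (weilConv φ (weilReflect φ) (Real.log n) + weilConv φ (weilReflect φ) (-Real.log n))).re) →
      (∀ σ : ℝ, 1 < σ → LSeriesSummable (fun n => ((c n : ℝ) : ℂ)) σ) →
      (∀ s₀ : ℂ, 1 / 2 < s₀.re → ∃ η : ℝ, 0 < η ∧ ∃ F : ℂ → ℂ,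
        DifferentiableOn ℂ F {s : ℂ | 1 / 2 < s.re ∧ s.re < s₀.re + 1 ∧ s₀.im - η < s.im ∧ s.im < s₀.im + η} ∧
        ∀ s ∈ {s : ℂ | 1 / 2 < s.re ∧ s.re < s₀.re + 1 ∧ s₀.im - η < s.im ∧ s.im < s₀.im + η},
          1 < s.re → F s = LSeries (fun n => ((c n : ℝ) : ℂ)) s - 1 / (s - 1)) →
      ∀ S : Finset ℕ, (∀ p ∈ S, p.Prime) → ∀ φ : ℝ,
        ∑ A ∈ S.powerset, (c (∏ p ∈ A, p) - Λ (∏ p ∈ A, p)) /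
            Real.sqrt (∏ p ∈ A, (p : ℝ)) * (1 / 2) ^ A.card * Real.cos ((A.card : ℝ) * φ) ≤ 0) :
    Theses.SignCone.ExactConeRigidity := by
  refine ExactConeRigidity_of_primeDomination fun c hc0 hc1 hU0 hsum hcont => ⟨∅, fun p hp _ => ?_⟩
  exact log_le_of_exactTorus_singleton hp hc1
    (hT0 c hc0 hc1 hU0 hsum hcont {p} (fun q hq => by rwa [Finset.mem_singleton.1 hq]) Real.pi)

/-- **`ExactConeRigidity` from the crux's registered stub `stub_torusIneq`** (crux `ConeMagnification`,
stmt-RiemannHypothesis-16303, line `Sketch`; hypothesis = that stub's signature verbatim).  An exact-cone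
weight has unit slack (`unitSlack_of_exact`), so the unit-slack torus inequality applies to it; the landed
finite spine `stub_deficitOfTorus` (p131512) turns it into deficit summability and the landed Landau transfer
`stub_transfer` (p130783) into RH.  Hence this item closes the moment `stub_torusIneq` lands. -/
theorem ExactConeRigidity_of_torusIneq
    (hT : ∀ c : ℕ → ℝ, (∀ n, 0 ≤ c n) → c 1 = 0 →
      (∀ g : ℝ → ℂ, IsWeilTest g →
        -(∫ t, ‖g t‖ ^ 2) ≤
          (weilPolarTerm (weilConv g (weilReflect g)) + weilArchTerm (weilConv g (weilReflect g)) -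
            ∑' n : ℕ, ((c n : ℝ) : ℂ) / (Real.sqrt n : ℂ) *
              (weilConv g (weilReflect g) (Real.log n) + weilConv g (weilReflect g) (-Real.log n))).re) →
      (∀ σ : ℝ, 1 < σ → LSeriesSummable (fun n => ((c n : ℝ) : ℂ)) σ) →
      (∀ s₀ : ℂ, 1 / 2 < s₀.re → ∃ η : ℝ, 0 < η ∧ ∃ F : ℂ → ℂ,
        DifferentiableOn ℂ F {s : ℂ | 1 / 2 < s.re ∧ s.re < s₀.re + 1 ∧ s₀.im - η < s.im ∧ s.im < s₀.im + η} ∧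
        ∀ s ∈ {s : ℂ | 1 / 2 < s.re ∧ s.re < s₀.re + 1 ∧ s₀.im - η < s.im ∧ s.im < s₀.im + η},
          1 < s.re → F s = LSeries (fun n => ((c n : ℝ) : ℂ)) s - 1 / (s - 1)) →
      ∀ S : Finset ℕ, (∀ p ∈ S, p.Prime) → ∀ φ : ℝ,
        ∑ A ∈ S.powerset, (c (∏ p ∈ A, p) - ArithmeticFunction.vonMangoldt (∏ p ∈ A, p)) /
            Real.sqrt (∏ p ∈ A, (p : ℝ)) * (1 / 2) ^ A.card * Real.cos ((A.card : ℝ) * φ) ≤ 1 / 2) :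
    Theses.SignCone.ExactConeRigidity := by
  intro hexact
  obtain ⟨c, hc0, hc1, hU0⟩ := exists_exactWeight_of_exactSignCone hexact
  have hU1 := unitSlack_of_exact hU0
  obtain ⟨hsum, hcont⟩ := exactWeight_continuation hc0 hU0
  exact stub_transfer c hc0 hsum hcont (stub_deficitOfTorus c hc0 (hT c hc0 hc1 hU1 hsum hcont))

end Summit.RiemannHypothesis.RiemannHypothesis.Theorems.SignConeExactConeRigidity
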